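import Literature.MathematicalPhysics.QuantumLattice.HubbardLiebBasis
import Literature.MathematicalPhysics.QuantumLattice.HubbardModelParticleHoleProofs
import HarnessLib

/-!
# Two-species coefficient matrices on the whole Fock space

Trunk T-QLATTICE, family `hubbard`. Lieb's coefficient matrix `W_{αβ} = σ(α, β) ψ(α↑ ∪ β↓)`
(E. H. Lieb, *Two theorems on the Hubbard model*, PRL **62** (1989) 1201, proof of Theorem 1,
"`ψ = Σ W_{αβ} ψ^α_↑ ⊗ ψ^β_↓`") written for ALL pairs of subsets `(α, β)` of the site set, i.e. the
tensor factorisation `ℓ²(Finset (Λ × {↑,↓})) ≅ ℓ²(Finset Λ) ⊗ ℓ²(Finset Λ)` of the site-major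
Jordan–Wigner model of `HubbardWave0`, with the signs `σ = pairSign` of `HubbardLiebConfig`.

The tree already has the `(n, n)`-sector version `liebW n` (`HubbardLiebConfig`,
`LiebThm1.liebW_hamiltonian_mulVec`) and the hole–particle transformed version `LiebTwo.toFock`
(`HubbardLiebBasis`). What is added here, and needed by finite-cluster computations that move
BETWEEN sectors `(a, b)` with `a ≠ b` (pair operators, single fermion operators):

* `coeffMatrix ψ`, its inverse `ofCoeffMatrix`, linearity, unitarity
  (`star_dotProduct_eq_sum_coeffMatrix`), and the sector criterion `isInSector_iff_coeffMatrix`;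
* the transfer of the four elementary fermion operators: `c_{x↑} ↦ c_x · W`, `c†_{x↑} ↦ c†_x · W`,
  `c_{x↓} ↦ P · W · c_xᵀ`, `c†_{x↓} ↦ P · W · (c†_x)ᵀ` with the spinless Jordan–Wigner matrices
  `annihilation x`, `creation x` on `Finset Λ` and the up-parity `P = upParity = diag (-1)^{#α}`
  (`coeffMatrix_annihilation_up_mulVec`, …);
* consequently the hopping terms act by left/right multiplication, `n_{x↑} n_{x↓} ↦ n_x W n_x`,
  and the Hubbard Hamiltonian acts as Lieb's operator `W ↦ K W + W K + U Σ_x n_x W n_x`,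
  `K = hoppingMatrix G t` (`coeffMatrix_hamiltonian_mulVec`, Lieb's eq. (4) on the whole Fock space).

All proofs are entrywise computations with the sign calculus of `HubbardLiebConfig`,
`HubbardWave0LiebProofs` and `HubbardLiebBasis`; nothing there is re-proved.

Sources: Lieb, PRL 62 (1989) 1201, proof of Theorem 1, eqs. (3)–(4); H. Tasaki, *Physics and
Mathematics of Quantum Many-Body Systems* (2020) §9.2.1 (Jordan–Wigner signs).
-/

noncomputable section

namespace Literature.MathematicalPhysics.QuantumLattice

open Matrix Finset LiebThm1

namespace TwoSpecies

variable {Λ : Type*} [LinearOrder Λ] [Fintype Λ]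

/-- Lieb's coefficient matrix of a Fock vector on ALL pairs of subsets:
`W_{αβ} = σ(α, β) ψ(α↑ ∪ β↓)` (`σ = pairSign`; on `n`-subsets this is `liebW n ψ`).
Lieb, PRL 62 (1989) 1201, proof of Theorem 1. [cite: LiebPRL1989, proof of Theorem 1] -/
def coeffMatrix (ψ : Fock (Orb Λ)) : Matrix (Finset Λ) (Finset Λ) ℂ :=
  fun α β => pairSign α β * ψ (pairSet α β)

/-- The Fock vector with coefficient matrix `W` (inverse of `coeffMatrix`).
Lieb, PRL 62 (1989) 1201, proof of Theorem 1. [cite: LiebPRL1989, proof of Theorem 1] -/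
def ofCoeffMatrix (W : Matrix (Finset Λ) (Finset Λ) ℂ) : Fock (Orb Λ) :=
  fun s => pairSign (upPart s) (downPart s) * W (upPart s) (downPart s)

/-- The up-parity `P = diag (-1)^{#α}` on spinless configurations (the sign a down-spin fermion
operator picks up from all up electrons in the site-major orbital order).
Tasaki (2020) §9.2.1. [cite: Tasaki2020, §9.2.1] -/
def upParity : Matrix (Finset Λ) (Finset Λ) ℂ := diagonal fun α => (-1) ^ α.card

/-- Unfolding lemma for `coeffMatrix`. [folklore] -/
theorem coeffMatrix_apply (ψ : Fock (Orb Λ)) (α β : Finset Λ) :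
    coeffMatrix ψ α β = pairSign α β * ψ (pairSet α β) := rfl

/-- `coeffMatrix` is additive. [folklore] -/
theorem coeffMatrix_add (ψ φ : Fock (Orb Λ)) :
    coeffMatrix (ψ + φ) = coeffMatrix ψ + coeffMatrix φ := by
  ext α β; simp [coeffMatrix_apply, mul_add]

/-- `coeffMatrix` is homogeneous. [folklore] -/
theorem coeffMatrix_smul (c : ℂ) (ψ : Fock (Orb Λ)) :
    coeffMatrix (c • ψ) = c • coeffMatrix ψ := by
  ext α β; simp [coeffMatrix_apply, mul_left_comm]

/-- `coeffMatrix 0 = 0`. [folklore] -/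
@[simp] theorem coeffMatrix_zero : coeffMatrix (0 : Fock (Orb Λ)) = 0 := by
  ext α β; simp [coeffMatrix_apply]

/-- `coeffMatrix` respects subtraction. [folklore] -/
theorem coeffMatrix_sub (ψ φ : Fock (Orb Λ)) :
    coeffMatrix (ψ - φ) = coeffMatrix ψ - coeffMatrix φ := by
  ext α β; simp [coeffMatrix_apply, mul_sub]

/-- `coeffMatrix` commutes with finite sums. [folklore] -/
theorem coeffMatrix_sum {ι : Type*} (S : Finset ι) (ψ : ι → Fock (Orb Λ)) :
    coeffMatrix (∑ i ∈ S, ψ i) = ∑ i ∈ S, coeffMatrix (ψ i) := by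
  classical
  induction S using Finset.induction_on with
  | empty => simp
  | insert a S ha ih => rw [Finset.sum_insert ha, Finset.sum_insert ha, coeffMatrix_add, ih]

/-- `ofCoeffMatrix ∘ coeffMatrix = id`. [folklore] -/
theorem ofCoeffMatrix_coeffMatrix (ψ : Fock (Orb Λ)) : ofCoeffMatrix (coeffMatrix ψ) = ψ := by
  funext s
  rw [ofCoeffMatrix, coeffMatrix_apply, pairSet_upPart_downPart, ← mul_assoc, pairSign_mul_self,
    one_mul]

/-- `coeffMatrix ∘ ofCoeffMatrix = id`. [folklore] -/
theorem coeffMatrix_ofCoeffMatrix (W : Matrix (Finset Λ) (Finset Λ) ℂ) :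
    coeffMatrix (ofCoeffMatrix W) = W := by
  ext α β
  rw [coeffMatrix_apply, ofCoeffMatrix]
  simp only [upPart_pairSet, downPart_pairSet]
  rw [← mul_assoc, pairSign_mul_self, one_mul]

/-- `coeffMatrix` is injective. [folklore] -/
theorem coeffMatrix_injective : Function.Injective (coeffMatrix (Λ := Λ)) := fun ψ φ h => by
  rw [← ofCoeffMatrix_coeffMatrix ψ, h, ofCoeffMatrix_coeffMatrix]

/-- `ψ = 0 ↔ W(ψ) = 0`. [folklore] -/
theorem coeffMatrix_eq_zero_iff (ψ : Fock (Orb Λ)) : coeffMatrix ψ = 0 ↔ ψ = 0 := by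
  constructor
  · intro h
    exact coeffMatrix_injective (h.trans coeffMatrix_zero.symm)
  · rintro rfl; exact coeffMatrix_zero

/-- **Unitarity**: `⟨ψ, φ⟩ = Σ_{α, β} conj W(ψ)_{αβ} · W(φ)_{αβ}` (Lieb: "`⟨ψ|ψ⟩ = Σ |W_{αβ}|²`").
Lieb, PRL 62 (1989) 1201, proof of Theorem 1. [cite: LiebPRL1989, proof of Theorem 1] -/
theorem star_dotProduct_eq_sum_coeffMatrix (ψ φ : Fock (Orb Λ)) :
    star ψ ⬝ᵥ φ = ∑ α : Finset Λ, ∑ β : Finset Λ, star (coeffMatrix ψ α β) * coeffMatrix φ α β := by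
  have key : ∀ α β : Finset Λ, star (coeffMatrix ψ α β) * coeffMatrix φ α β =
      star (ψ (pairSet α β)) * φ (pairSet α β) := by
    intro α β
    rw [coeffMatrix_apply, coeffMatrix_apply, star_mul, star_pairSign]
    linear_combination (star (ψ (pairSet α β)) * φ (pairSet α β)) * pairSign_mul_self α β
  simp only [key]
  rw [← Fintype.sum_prod_type']
  symm
  refine Fintype.sum_equiv configEquiv.symm _ _ fun p => ?_
  rfl

/-- The squared norm: `⟨ψ, ψ⟩ = Σ_{α, β} |W(ψ)_{αβ}|²`. Lieb, PRL 62 (1989) 1201, proof of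
Theorem 1. [cite: LiebPRL1989, proof of Theorem 1] -/
theorem star_dotProduct_self_eq_sum_coeffMatrix (ψ : Fock (Orb Λ)) :
    star ψ ⬝ᵥ ψ = ∑ α : Finset Λ, ∑ β : Finset Λ, ((‖coeffMatrix ψ α β‖ ^ 2 : ℝ) : ℂ) := by
  rw [star_dotProduct_eq_sum_coeffMatrix]
  refine Finset.sum_congr rfl fun α _ => Finset.sum_congr rfl fun β _ => ?_
  rw [Complex.star_def, Complex.conj_mul', Complex.ofReal_pow]

/-- **Sector criterion**: `ψ` has `a` up and `b` down electrons iff its coefficient matrix is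
supported on `a`-subsets × `b`-subsets. Lieb, PRL 62 (1989) 1201, proof of Theorem 1. [cite: LiebPRL1989, proof of Theorem 1] -/
theorem isInSector_iff_coeffMatrix (a b : ℕ) (ψ : Fock (Orb Λ)) :
    IsInSector a b ψ ↔ ∀ α β : Finset Λ, ¬(α.card = a ∧ β.card = b) → coeffMatrix ψ α β = 0 := by
  constructor
  · intro h α β hab
    rw [coeffMatrix_apply, h (pairSet α β) (by simpa using hab), mul_zero]
  · intro h s hs
    have h1 := h (upPart s) (downPart s) hs
    rw [coeffMatrix_apply, pairSet_upPart_downPart] at h1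
    exact (mul_eq_zero.1 h1).resolve_left (pairSign_ne_zero _ _)

/-- A vector built from a coefficient matrix supported on `a`-subsets × `b`-subsets lies in the
sector `(a, b)`. [folklore] -/
theorem isInSector_ofCoeffMatrix {a b : ℕ} {W : Matrix (Finset Λ) (Finset Λ) ℂ}
    (hW : ∀ α β : Finset Λ, ¬(α.card = a ∧ β.card = b) → W α β = 0) :
    IsInSector a b (ofCoeffMatrix W) := by
  rw [isInSector_iff_coeffMatrix, coeffMatrix_ofCoeffMatrix]
  exact hW

/-! ### Transfer of the elementary fermion operators -/

/-- `c_{x↑}` acts on coefficient matrices as left multiplication by the spinless `c_x`: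
`W(c_{x↑} ψ) = c_x · W(ψ)` (the down-electron signs are absorbed by `σ`).
Lieb, PRL 62 (1989) 1201, proof of Theorem 1; Tasaki (2020) §9.2.1. [cite: LiebPRL1989, proof of Theorem 1] -/
theorem coeffMatrix_annihilation_up_mulVec (x : Λ) (ψ : Fock (Orb Λ)) :
    coeffMatrix (annihilation (orb x 0) *ᵥ ψ) = annihilation x * coeffMatrix ψ := by
  ext α β
  rw [coeffMatrix_apply, annihilation_mulVec_apply, Matrix.mul_apply]
  simp only [orb_zero_mem_pairSet, jwSign_orb_zero, pairSet_insert_zero, coeffMatrix_apply]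
  rw [sum_annihilation_mul x α (fun t => pairSign t β * ψ (pairSet t β))]
  by_cases hx : x ∈ α
  · rw [if_neg (not_not_intro hx), if_neg (not_not_intro hx), mul_zero]
  · rw [if_pos hx, if_pos hx, pairSign_insert_left hx]
    ring

/-- `c†_{x↑}` acts as left multiplication by the spinless `c†_x`: `W(c†_{x↑} ψ) = c†_x · W(ψ)`.
Lieb, PRL 62 (1989) 1201, proof of Theorem 1. [cite: LiebPRL1989, proof of Theorem 1] -/
theorem coeffMatrix_creation_up_mulVec (x : Λ) (ψ : Fock (Orb Λ)) :
    coeffMatrix (creation (orb x 0) *ᵥ ψ) = creation x * coeffMatrix ψ := by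
  ext α β
  rw [coeffMatrix_apply, creation_mulVec_apply, Matrix.mul_apply]
  simp only [orb_zero_mem_pairSet, pairSet_erase_zero, jwSign_orb_zero, coeffMatrix_apply]
  rw [sum_creation_mul x α (fun t => pairSign t β * ψ (pairSet t β))]
  by_cases hx : x ∈ α
  · rw [if_pos hx, if_pos hx]
    have h1 : pairSign α β = jwSign x β * pairSign (α.erase x) β := by
      conv_lhs => rw [← insert_erase hx]
      exact pairSign_insert_left (notMem_erase x α) β
    rw [h1]
    linear_combination (jwSign x (α.erase x) * pairSign (α.erase x) β *
      ψ (pairSet (α.erase x) β)) * jwSign_mul_self x β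
  · rw [if_neg hx, if_neg hx, mul_zero]

/-- `c_{x↓}` acts as `W(c_{x↓} ψ) = P · W(ψ) · c_xᵀ` with the up-parity `P` (the Jordan–Wigner string
of a down orbital runs through all up orbitals). Tasaki (2020) §9.2.1. [cite: Tasaki2020, §9.2.1] -/
theorem coeffMatrix_annihilation_down_mulVec (x : Λ) (ψ : Fock (Orb Λ)) :
    coeffMatrix (annihilation (orb x 1) *ᵥ ψ) = upParity * coeffMatrix ψ * (annihilation x)ᵀ := by
  ext α β
  rw [coeffMatrix_apply, annihilation_mulVec_apply, Matrix.mul_apply]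
  simp only [orb_one_mem_pairSet, jwSign_orb_one', pairSet_insert_one, transpose_apply, upParity,
    diagonal_mul, coeffMatrix_apply]
  have hs : ∑ t, (-1) ^ α.card * (pairSign α t * ψ (pairSet α t)) * annihilation x β t =
      (-1) ^ α.card * ∑ t, annihilation x β t * (pairSign α t * ψ (pairSet α t)) := by
    rw [Finset.mul_sum]
    exact Finset.sum_congr rfl fun t _ => by ring
  rw [hs, sum_annihilation_mul x β (fun t => pairSign α t * ψ (pairSet α t))]
  by_cases hx : x ∈ β
  · rw [if_neg (not_not_intro hx), if_neg (not_not_intro hx), mul_zero, mul_zero]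
  · rw [if_pos hx, if_pos hx, pairSign_insert_right α hx]
    ring

/-- `c†_{x↓}` acts as `W(c†_{x↓} ψ) = P · W(ψ) · (c†_x)ᵀ`. Tasaki (2020) §9.2.1. [cite: Tasaki2020, §9.2.1] -/
theorem coeffMatrix_creation_down_mulVec (x : Λ) (ψ : Fock (Orb Λ)) :
    coeffMatrix (creation (orb x 1) *ᵥ ψ) = upParity * coeffMatrix ψ * (creation x)ᵀ := by
  ext α β
  rw [coeffMatrix_apply, creation_mulVec_apply, Matrix.mul_apply]
  simp only [orb_one_mem_pairSet, pairSet_erase_one, jwSign_orb_one', transpose_apply, upParity,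
    diagonal_mul, coeffMatrix_apply]
  have hs : ∑ t, (-1) ^ α.card * (pairSign α t * ψ (pairSet α t)) * creation x β t =
      (-1) ^ α.card * ∑ t, creation x β t * (pairSign α t * ψ (pairSet α t)) := by
    rw [Finset.mul_sum]
    exact Finset.sum_congr rfl fun t _ => by ring
  rw [hs, sum_creation_mul x β (fun t => pairSign α t * ψ (pairSet α t))]
  by_cases hx : x ∈ β
  · rw [if_pos hx, if_pos hx]
    have h1 : pairSign α β = gtSign x α * pairSign α (β.erase x) := by
      conv_lhs => rw [← insert_erase hx]
      exact pairSign_insert_right α (notMem_erase x β)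
    rw [h1]
    linear_combination ((-1) ^ α.card * jwSign x (β.erase x) * pairSign α (β.erase x) *
      ψ (pairSet α (β.erase x))) * gtSign_mul_self x α
  · rw [if_neg hx, if_neg hx, mul_zero, mul_zero]

/-- `P² = 1`. [folklore] -/
theorem upParity_mul_upParity : (upParity : Matrix (Finset Λ) (Finset Λ) ℂ) * upParity = 1 := by
  rw [upParity, diagonal_mul_diagonal, ← diagonal_one]
  congr 1
  funext α
  rw [← mul_pow, neg_mul_neg, one_mul, one_pow]

/-! ### Hopping terms, interaction, and the Hubbard Hamiltonian -/

/-- Up-spin hopping acts from the left: `W(c†_{x↑} c_{y↑} ψ) = (c†_x c_y) W(ψ)` (Lieb's term `K W`).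
Lieb, PRL 62 (1989) 1201, eq. (4). [cite: LiebPRL1989, eq. (4)] -/
theorem coeffMatrix_hopping_up_mulVec (x y : Λ) (ψ : Fock (Orb Λ)) :
    coeffMatrix ((creation (orb x 0) * annihilation (orb y 0)) *ᵥ ψ) =
      creation x * annihilation y * coeffMatrix ψ := by
  rw [← mulVec_mulVec, coeffMatrix_creation_up_mulVec, coeffMatrix_annihilation_up_mulVec,
    Matrix.mul_assoc]

/-- Down-spin hopping acts from the right: `W(c†_{x↓} c_{y↓} ψ) = W(ψ) (c†_x c_y)ᵀ` (Lieb's term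
`W K`). Lieb, PRL 62 (1989) 1201, eq. (4). [cite: LiebPRL1989, eq. (4)] -/
theorem coeffMatrix_hopping_down_mulVec (x y : Λ) (ψ : Fock (Orb Λ)) :
    coeffMatrix ((creation (orb x 1) * annihilation (orb y 1)) *ᵥ ψ) =
      coeffMatrix ψ * (creation x * annihilation y)ᵀ := by
  rw [← mulVec_mulVec, coeffMatrix_creation_down_mulVec, coeffMatrix_annihilation_down_mulVec,
    transpose_mul]
  calc upParity * (upParity * coeffMatrix ψ * (annihilation y)ᵀ) * (creation x)ᵀ
      = (upParity * upParity) * coeffMatrix ψ * ((annihilation y)ᵀ * (creation x)ᵀ) := by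
        simp only [Matrix.mul_assoc]
    _ = coeffMatrix ψ * ((annihilation y)ᵀ * (creation x)ᵀ) := by
        rw [upParity_mul_upParity, Matrix.one_mul]

/-- The on-site repulsion acts as `W(n_{x↑} n_{x↓} ψ) = n_x W(ψ) n_x` (Lieb's term `L_x W L_x`).
Lieb, PRL 62 (1989) 1201, eq. (4). [cite: LiebPRL1989, eq. (4)] -/
theorem coeffMatrix_numberOp_mul_numberOp_mulVec (x : Λ) (ψ : Fock (Orb Λ)) :
    coeffMatrix ((numberOp x 0 * numberOp x 1) *ᵥ ψ) = numberAt x * coeffMatrix ψ * numberAt x := by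
  have hT : (numberAt x : Matrix (Finset Λ) (Finset Λ) ℂ)ᵀ = numberAt x := by
    rw [numberAt_eq_diagonal, diagonal_transpose]
  unfold numberOp
  rw [← mulVec_mulVec, coeffMatrix_hopping_up_mulVec, coeffMatrix_hopping_down_mulVec, ← numberAt,
    hT, Matrix.mul_assoc]

variable (G : SimpleGraph Λ) [DecidableRel G.Adj]

/-- The spinless hopping matrix is symmetric. Lieb, PRL 62 (1989) 1201, proof of Theorem 1
("`K` is real and symmetric"). [cite: LiebPRL1989, proof of Theorem 1] -/
theorem hoppingMatrix_transpose (t : ℝ) : (hoppingMatrix G t)ᵀ = hoppingMatrix G t := by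
  ext α β
  exact hoppingMatrix_transpose_apply t α β

/-- **Lieb's eq. (4) on the whole Fock space**: the Hubbard Hamiltonian acts on coefficient
matrices as `W(H ψ) = K W + W K + U Σ_x n_x W n_x`, `K = hoppingMatrix G t` the spinless hopping
matrix (both species see the same `K`), `n_x = numberAt x`.
Lieb, PRL 62 (1989) 1201, eq. (4). [cite: LiebPRL1989, eq. (4)] -/
theorem coeffMatrix_hamiltonian_mulVec (t U : ℝ) (ψ : Fock (Orb Λ)) :
    coeffMatrix (hamiltonian G t U *ᵥ ψ) =
      hoppingMatrix G t * coeffMatrix ψ + coeffMatrix ψ * hoppingMatrix G t +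
        (U : ℂ) • ∑ x : Λ, numberAt x * coeffMatrix ψ * numberAt x := by
  set W := coeffMatrix ψ with hW
  set A : Matrix (Finset Λ) (Finset Λ) ℂ := ∑ x : Λ, ∑ y : Λ,
    if G.Adj x y then creation x * annihilation y else 0 with hA
  have hhop : ∀ x y : Λ, ∑ σ : Fin 2, coeffMatrix ((if G.Adj x y then
      creation (orb x σ) * annihilation (orb y σ) else (0 : Matrix _ _ ℂ)) *ᵥ ψ) =
      (if G.Adj x y then creation x * annihilation y else 0) * W +
        W * (if G.Adj x y then creation x * annihilation y else 0)ᵀ := by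
    intro x y
    rw [Fin.sum_univ_two]
    by_cases h : G.Adj x y
    · simp only [if_pos h, coeffMatrix_hopping_up_mulVec, coeffMatrix_hopping_down_mulVec, hW]
    · simp only [if_neg h, zero_mulVec, coeffMatrix_zero, Matrix.zero_mul, transpose_zero,
        Matrix.mul_zero, add_zero]
  have hT : coeffMatrix ((∑ x : Λ, ∑ y : Λ, ∑ σ : Fin 2, if G.Adj x y then
      creation (orb x σ) * annihilation (orb y σ) else (0 : Matrix _ _ ℂ)) *ᵥ ψ) =
      A * W + W * Aᵀ := by
    simp only [sum_mulVec, coeffMatrix_sum, hhop, Finset.sum_add_distrib, hA, transpose_sum,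
      Matrix.sum_mul, Matrix.mul_sum]
  have hV : coeffMatrix ((∑ x : Λ, (numberOp x 0 * numberOp x 1 : Matrix _ _ ℂ)) *ᵥ ψ) =
      ∑ x, numberAt x * W * numberAt x := by
    simp only [sum_mulVec, coeffMatrix_sum, coeffMatrix_numberOp_mul_numberOp_mulVec, hW]
  have hK : hoppingMatrix G t = -(t : ℂ) • A := rfl
  have hKT : (-(t : ℂ) • A)ᵀ = -(t : ℂ) • A := by rw [← hK, hoppingMatrix_transpose]
  unfold hamiltonian
  rw [add_mulVec, smul_mulVec, smul_mulVec, coeffMatrix_add, coeffMatrix_smul, coeffMatrix_smul,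
    hT, hV, hK]
  conv_rhs => rw [show W * (-(t : ℂ) • A) = W * (-(t : ℂ) • A)ᵀ by rw [hKT]]
  rw [transpose_smul, Matrix.smul_mul, Matrix.mul_smul, smul_add]

end TwoSpecies

end Literature.MathematicalPhysics.QuantumLattice
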